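import Mathlib
import Summits.Ventures.PercRepro2.PMK5Typed
import Summits.Ventures.PercRepro2.PMK5Strict
import Summits.Ventures.PercRepro2.PMK5Locus
import Summits.Ventures.PercRepro2.PMK5LocusFace
import Summits.Ventures.PercRepro2.PMK5LocusZero
import Summits.Ventures.PercRepro2.PMK5LocusA

/-!
# THE EQUALITY LOCUS OF `A (the a₃-inactive piece)` ON FIVE-VERTEX BASES — THE ZERO SIDE AND THE TWO «IFF»s
(blind cell PercRepro2, mine-2 g23; the `A`-companion of `PMK5LocusZero.lean`; on `PMK5LocusA.lean` (the
positive side, `RuleA`) and `PMK5LocusFace.lean` (restricted tables and their Kronecker numbers); row 2′BETA1)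

The `A`-degenerate edge sets (`RuleA`, the exact zero set of the class sums of `A (the a₃-inactive piece)`) form a down-set
with 6 maximal elements `MxA` (`coverZA`, one `decide +kernel`); on each of them the positive and the negative
restricted Kronecker numbers are EQUAL (`faceA_*`, 6 `decide +kernel`), so every coefficient supported inside a
degenerate face vanishes (`coefA_eq_of_face`), whence `a3_K5_zero_of_face`, and the two «iff»s
`a3_K5_pos_iff` / `a3_K5_zero_iff` (the centre of the face separates the cases).  Standard axioms.
-/

namespace Summit.Ventures.PercRepro2

open Hub

namespace K5

namespace PM

/-! ## The 6 maximal `A`-degenerate faces (kernel) -/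

set_option maxRecDepth 100000 in
/-- The restricted numbers of `A (the a₃-inactive piece)` agree on the face `249` = {01 04 12 13 14 23}. -/
theorem faceA_249 : kPosAm 249 = kNegAm 249 := by
  decide +kernel

set_option maxRecDepth 100000 in
/-- The restricted numbers of `A (the a₃-inactive piece)` agree on the face `442` = {02 04 12 13 23 24}. -/
theorem faceA_442 : kPosAm 442 = kNegAm 442 := by
  decide +kernel

set_option maxRecDepth 100000 in
/-- The restricted numbers of `A (the a₃-inactive piece)` agree on the face `503` = {01 02 03 12 13 14 23 24}. -/
theorem faceA_503 : kPosAm 503 = kNegAm 503 := by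
  decide +kernel

set_option maxRecDepth 100000 in
/-- The restricted numbers of `A (the a₃-inactive piece)` agree on the face `637` = {01 03 04 12 13 14 34}. -/
theorem faceA_637 : kPosAm 637 = kNegAm 637 := by
  decide +kernel

set_option maxRecDepth 100000 in
/-- The restricted numbers of `A (the a₃-inactive piece)` agree on the face `926` = {02 03 04 12 23 24 34}. -/
theorem faceA_926 : kPosAm 926 = kNegAm 926 := by
  decide +kernel

set_option maxRecDepth 100000 in
/-- The restricted numbers of `A (the a₃-inactive piece)` agree on the face `1011` = {01 02 12 13 14 23 24 34}. -/
theorem faceA_1011 : kPosAm 1011 = kNegAm 1011 := by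
  decide +kernel

/-- **Every coefficient of `A (the a₃-inactive piece)` supported inside a face with equal restricted numbers vanishes.** -/
theorem coefA_eq_of_face (m : ℕ) (hz : kPosAm m = kNegAm m) (k : Fin 10 → Fin 4)
    (hk : ∀ e : Fin 10, k e ≠ 0 → m.testBit e = true) : cntPosA k = cntNegA k := by
  have h := eq_of_kron_eq _ _ (cntPosAm_lt m) (cntNegAm_lt m) (kPosAm_eq m) (kNegAm_eq m) hz k
  unfold cntPosAm cntNegAm at h
  simp only [cnt3_restr_eq hk] at h
  unfold cntPosA cntNegA
  omega

/-- The 6 maximal `A`-degenerate edge sets. -/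
def MxA : Fin 6 → ℕ := ![249, 442, 503, 637, 926, 1011]

set_option maxRecDepth 100000 in
/-- **Every `A`-degenerate edge set lies inside one of the maximal ones.** -/
theorem coverZA : ∀ m : Fin 1024, RuleA m = true →
    ∃ i : Fin 6, ∀ e : Fin 10, (m : ℕ).testBit e = true → (MxA i).testBit e = true := by
  decide +kernel

/-- The restricted numbers agree on each maximal `A`-degenerate face. -/
theorem faceA_all : ∀ i : Fin 6, kPosAm (MxA i) = kNegAm (MxA i) := by
  intro i
  fin_cases i
  exacts [faceA_249, faceA_442, faceA_503, faceA_637, faceA_926, faceA_1011]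

section Face

variable {R : Type*} [Field R] [LinearOrder R] [IsStrictOrderedRing R]

omit [LinearOrder R] [IsStrictOrderedRing R] in
/-- **THE EQUALITY LOCUS OF `A (the a₃-inactive piece)` — THE ZERO SIDE**: on every `A`-degenerate edge set `m` the cleared
`A (the a₃-inactive piece)` vanishes at every weight vector supported on `m`. -/
theorem a3_K5_zero_of_face (m : ℕ) (hm : m < 1024) (hr : RuleA m = true) (p : Fin 10 → R)
    (hp₀ : ∀ e : Fin 10, m.testBit e = false → p e = 0) :
    
    (prob p ((connEvent ends5 1 3 ∪ connEvent ends5 2 3) ∩ (connEvent ends5 1 2)ᶜ) -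
          prob p (connEvent ends5 1 2)ᶜ) *
        (prob p (connEvent ends5 1 2)ᶜ *
              prob p (connEvent ends5 1 4 ∩ connEvent ends5 2 0 ∩ (connEvent ends5 1 2)ᶜ) -
            prob p (connEvent ends5 1 4 ∩ (connEvent ends5 1 2)ᶜ) *
              prob p (connEvent ends5 2 0 ∩ (connEvent ends5 1 2)ᶜ) +
          prob p (connEvent ends5 1 2)ᶜ *
              prob p (connEvent ends5 2 4 ∩ connEvent ends5 1 0 ∩ (connEvent ends5 1 2)ᶜ) -
            prob p (connEvent ends5 2 4 ∩ (connEvent ends5 1 2)ᶜ) *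
              prob p (connEvent ends5 1 0 ∩ (connEvent ends5 1 2)ᶜ)) = 0 := by
  rw [a3_eq_bern]
  refine Finset.sum_eq_zero fun k _ => ?_
  by_cases hk : ∀ e : Fin 10, k e ≠ 0 → m.testBit e = true
  · obtain ⟨i, hi⟩ := coverZA ⟨m, hm⟩ hr
    have hc := coefA_eq_of_face (MxA i) (faceA_all i) k fun e he => hi e (hk e he)
    rw [hc, sub_self, mul_zero]
  · obtain ⟨e, he⟩ := not_forall.1 hk
    obtain ⟨hke, hme⟩ := Classical.not_imp.1 he
    have hpe : p e = 0 := hp₀ e (by simpa using hme)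
    have hb : bern p k = 0 := by
      unfold bern
      apply Finset.prod_eq_zero (Finset.mem_univ e)
      rw [hpe, zero_pow (fun h => hke (Fin.ext (by simpa using h)))]
      simp
    rw [hb, zero_mul]

/-- **THE EQUALITY LOCUS OF `A (the a₃-inactive piece)`, FIRST «IFF»**: strictly positive on the whole open face ⟺ not
`A`-degenerate. -/
theorem a3_K5_pos_iff (m : ℕ) (hm : m < 1024) :
    (∀ p : Fin 10 → R, (∀ e : Fin 10, m.testBit e = true → 0 < p e ∧ p e < 1) →
      (∀ e : Fin 10, m.testBit e = false → p e = 0) →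
      0 < 
    (prob p ((connEvent ends5 1 3 ∪ connEvent ends5 2 3) ∩ (connEvent ends5 1 2)ᶜ) -
          prob p (connEvent ends5 1 2)ᶜ) *
        (prob p (connEvent ends5 1 2)ᶜ *
              prob p (connEvent ends5 1 4 ∩ connEvent ends5 2 0 ∩ (connEvent ends5 1 2)ᶜ) -
            prob p (connEvent ends5 1 4 ∩ (connEvent ends5 1 2)ᶜ) *
              prob p (connEvent ends5 2 0 ∩ (connEvent ends5 1 2)ᶜ) +
          prob p (connEvent ends5 1 2)ᶜ *
              prob p (connEvent ends5 2 4 ∩ connEvent ends5 1 0 ∩ (connEvent ends5 1 2)ᶜ) -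
            prob p (connEvent ends5 2 4 ∩ (connEvent ends5 1 2)ᶜ) *
              prob p (connEvent ends5 1 0 ∩ (connEvent ends5 1 2)ᶜ))) ↔ RuleA m = false := by
  constructor
  · intro h
    rcases Bool.eq_false_or_eq_true (RuleA m) with hr | hr
    · exfalso
      have hpos := h (centre (R := R) m) (fun e he => centre_on_pos he) (fun e he => centre_off he)
      have hzero := a3_K5_zero_of_face m hm hr (centre (R := R) m) (fun e he => centre_off he)
      rw [hzero] at hpos
      exact lt_irrefl _ hpos
    · exact hr
  · intro hr p hp₁ hp₀
    exact a3_K5_pos_of_face m hm hr p hp₁ hp₀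

/-- **THE EQUALITY LOCUS OF `A (the a₃-inactive piece)`, SECOND «IFF»**: identically zero on the face ⟺ `A`-degenerate. -/
theorem a3_K5_zero_iff (m : ℕ) (hm : m < 1024) :
    (∀ p : Fin 10 → R, (∀ e : Fin 10, 0 ≤ p e ∧ p e ≤ 1) →
      (∀ e : Fin 10, m.testBit e = false → p e = 0) →
      
    (prob p ((connEvent ends5 1 3 ∪ connEvent ends5 2 3) ∩ (connEvent ends5 1 2)ᶜ) -
          prob p (connEvent ends5 1 2)ᶜ) *
        (prob p (connEvent ends5 1 2)ᶜ *
              prob p (connEvent ends5 1 4 ∩ connEvent ends5 2 0 ∩ (connEvent ends5 1 2)ᶜ) -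
            prob p (connEvent ends5 1 4 ∩ (connEvent ends5 1 2)ᶜ) *
              prob p (connEvent ends5 2 0 ∩ (connEvent ends5 1 2)ᶜ) +
          prob p (connEvent ends5 1 2)ᶜ *
              prob p (connEvent ends5 2 4 ∩ connEvent ends5 1 0 ∩ (connEvent ends5 1 2)ᶜ) -
            prob p (connEvent ends5 2 4 ∩ (connEvent ends5 1 2)ᶜ) *
              prob p (connEvent ends5 1 0 ∩ (connEvent ends5 1 2)ᶜ)) = 0) ↔ RuleA m = true := by
  constructor
  · intro h
    rcases Bool.eq_false_or_eq_true (RuleA m) with hr | hr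
    · exact hr
    · exfalso
      have hpos := a3_K5_pos_of_face m hm hr (centre (R := R) m)
        (fun e he => centre_on_pos he) (fun e he => centre_off he)
      have hzero := h (centre (R := R) m) (centre_01 m) (fun e he => centre_off he)
      rw [hzero] at hpos
      exact lt_irrefl _ hpos
  · intro hr p _ hp₀
    exact a3_K5_zero_of_face m hm hr p hp₀

end Face

end PM

end K5

end Summit.Ventures.PercRepro2
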